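import Literature.NumberTheory.LFunctions.PolyaSignChangesMomentDefs
import Literature.NumberTheory.LFunctions.PolyaSignChangesPolePairAsymptotics
import Mathlib.Analysis.Complex.Exponential

/-!
# Pólya's sign-change theorem by the moment method — truncated moments (PieceA, §§2–4)

Topic `Literature/NumberTheory/LFunctions` (namespace `Literature.NumberTheory.LFunctions`,
grouping sub-namespace `PolyaSignChanges`).  Part of the A1 formalisation of
`PolyaSignChanges.Grosswald1967_thmB` (cell pub/rh-inputs, PieceA: skeleton stubs `stub_tail`,
`stub_polePair_taylor`, `stub_truncation`).  Nothing in this file bears on the truth of RH.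

## Content (all proved, sorry-free)

For admissible pole-pair data `AdmissiblePolePair g σ₁ λ x R' ρ Ψ` (see
`PolyaSignChangesMomentDefs.lean`):

* `stub_tail`: `∫_{(y,∞)} |g|(log t)^k t^{-(λ+1)} ≤ (log y)^k y^{-(λ−σ₁)} ∫_{(1,∞)} |g| t^{-(σ₁+1)}`
  for `log y ≥ k/(λ−σ₁)` (the weight `u^k e^{-(λ−σ₁)u}` decreases beyond `k/(λ−σ₁)`).
* `re_iteratedDeriv_eq_moment`: the moments ARE the Taylor data,
  `Re Ψ^{(k)}(λ) = (-1)^k ∫_{(1,∞)} g (log t)^k t^{-(λ+1)} dt` (via a measurable modification of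
  `g` on `(1,∞)`, so that no measurability hypothesis on `g` is needed).
* `stub_polePair_taylor` (skeleton signature): the sign of `(-1)^k Re Ψ^{(k)}(λ)` is the sign of
  `cos((m+k)φ + α)` on the good indices `|cos| ≥ 1/2`, `k ≥ k₀`.
* `stub_truncation` (skeleton signature plus the binder `1 ≤ y`, without which the typed stub
  fails for `y ≤ -1` since `Real.log (-t) = Real.log t`): the TRUNCATED moments
  `∫_{(1,y]} g (log t)^k t^{-(λ+1)}`, `log y ≥ xk/λ`, have the same sign — tail
  `≤ M k! b^k R^{-k}`, `b = x e^{1−x(λ−σ₁)/λ} R/λ < 1`, against the main term `≥ k! c₀ R^{-k}/8`.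
* `integrableOn_Ioc_rpow`: `g t^{-(λ+1)}` is integrable on `(1, y]` (input to the Laguerre step).

## References

* E. Grosswald, *Oscillation theorems of arithmetical functions*, TAMS 126 (1967) 1–28, §4 Thm B.
  [Grosswald1967]
-/

noncomputable section

open Complex Set Filter Topology Metric MeasureTheory

open scoped ComplexConjugate

namespace Literature.NumberTheory.LFunctions

namespace PolyaSignChanges

/-! ### The tail estimate -/

/-- `u ↦ u^k e^{-cu}` is non-increasing on `[k/c, ∞)` (`c > 0`). [folklore] -/
private theorem pow_mul_exp_neg_le {c u v : ℝ} {k : ℕ} (hc : 0 < c) (hv : (k : ℝ) / c ≤ v)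
    (hvu : v ≤ u) :
    u ^ k * Real.exp (-(c * u)) ≤ v ^ k * Real.exp (-(c * v)) := by
  rcases Nat.eq_zero_or_pos k with rfl | hk
  · simp only [pow_zero, one_mul]
    exact Real.exp_le_exp.2 (by nlinarith)
  · have hv0 : 0 < v := lt_of_lt_of_le (div_pos (Nat.cast_pos.2 hk) hc) hv
    have hu0 : 0 < u := hv0.trans_le hvu
    have hkv : (k : ℝ) ≤ c * v := by
      have := (div_le_iff₀ hc).1 hv
      linarith [mul_comm v c]
    have h1 : Real.log (u / v) ≤ u / v - 1 := Real.log_le_sub_one_of_pos (div_pos hu0 hv0)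
    have h2 : (k : ℝ) * (u / v - 1) ≤ c * (u - v) := by
      have huv : u / v - 1 = (u - v) / v := by field_simp
      rw [huv, mul_div_assoc', div_le_iff₀ hv0]
      nlinarith [sub_nonneg.2 hvu]
    have h3 : (k : ℝ) * Real.log (u / v) ≤ c * (u - v) :=
      le_trans (mul_le_mul_of_nonneg_left h1 (Nat.cast_nonneg k)) h2
    have h4 : (u / v) ^ k ≤ Real.exp (c * (u - v)) := by
      have := Real.exp_le_exp.2 h3
      rwa [← Real.log_pow, Real.exp_log (pow_pos (div_pos hu0 hv0) k)] at this
    rw [div_pow, div_le_iff₀ (pow_pos hv0 k)] at h4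
    calc u ^ k * Real.exp (-(c * u))
        ≤ Real.exp (c * (u - v)) * v ^ k * Real.exp (-(c * u)) := by gcongr
      _ = v ^ k * Real.exp (-(c * v)) := by
          rw [mul_comm (Real.exp _), mul_assoc, ← Real.exp_add]
          congr 2
          ring

/-- **The tail estimate** (`stub_tail` of the A1 skeleton).  For `σ₁ < λ`, `1 ≤ y` and
`log y ≥ k/(λ − σ₁)`:
`∫_{(y,∞)} |g| (log t)^k t^{-(λ+1)} dt ≤ (log y)^k · y^{-(λ−σ₁)} · ∫_{(1,∞)} |g| t^{-(σ₁+1)} dt`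
(the weight `(log t)^k t^{-(λ-σ₁)}` is non-increasing beyond `log t = k/(λ−σ₁)`; if the left
integrand is not integrable the left side is `0`).
[cite: Grosswald1967, §4 Thm B (moment method, tail step)] -/
theorem stub_tail (g : ℝ → ℝ) (σ₁ lam y : ℝ) (k : ℕ) (hσ : σ₁ < lam) (hy : 1 ≤ y)
    (hk : (k : ℝ) / (lam - σ₁) ≤ Real.log y)
    (hint : IntegrableOn (fun t : ℝ => g t * t ^ (-(σ₁ + 1))) (Ioi 1)) :
    ∫ t in Ioi y, |g t| * Real.log t ^ k * t ^ (-(lam + 1)) ≤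
      Real.log y ^ k * y ^ (-(lam - σ₁)) * ∫ t in Ioi 1, |g t| * t ^ (-(σ₁ + 1)) := by
  set c := lam - σ₁ with hc_def
  have hc : 0 < c := sub_pos.2 hσ
  have hy0 : 0 < y := one_pos.trans_le hy
  have habs : IntegrableOn (fun t : ℝ => |g t| * t ^ (-(σ₁ + 1))) (Ioi 1) := by
    refine hint.norm.congr ?_
    rw [Filter.EventuallyEq, ae_restrict_iff' measurableSet_Ioi]
    refine Filter.Eventually.of_forall fun t (ht : 1 < t) => ?_
    rw [norm_mul, Real.norm_eq_abs, Real.norm_eq_abs,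
      abs_of_pos (Real.rpow_pos_of_pos (one_pos.trans ht) _)]
  have habs_y : IntegrableOn (fun t : ℝ => |g t| * t ^ (-(σ₁ + 1))) (Ioi y) :=
    habs.mono_set (Ioi_subset_Ioi hy)
  have hpt : ∀ t ∈ Ioi y, |g t| * Real.log t ^ k * t ^ (-(lam + 1)) ≤
      Real.log y ^ k * y ^ (-c) * (|g t| * t ^ (-(σ₁ + 1))) := by
    intro t ht
    have ht0 : 0 < t := hy0.trans ht
    have hlog : Real.log y ≤ Real.log t := Real.log_le_log hy0 (le_of_lt ht)
    have hw : Real.log t ^ k * Real.exp (-(c * Real.log t)) ≤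
        Real.log y ^ k * Real.exp (-(c * Real.log y)) := pow_mul_exp_neg_le hc hk hlog
    have e1 : (t : ℝ) ^ (-(lam + 1)) = Real.exp (-(c * Real.log t)) * t ^ (-(σ₁ + 1)) := by
      rw [Real.rpow_def_of_pos ht0, Real.rpow_def_of_pos ht0, ← Real.exp_add]
      congr 1; rw [hc_def]; ring
    have e2 : (y : ℝ) ^ (-c) = Real.exp (-(c * Real.log y)) := by
      rw [Real.rpow_def_of_pos hy0]; congr 1; ring
    rw [e1, e2]
    have hg0 : 0 ≤ |g t| * t ^ (-(σ₁ + 1)) :=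
      mul_nonneg (abs_nonneg _) (Real.rpow_nonneg ht0.le _)
    calc |g t| * Real.log t ^ k * (Real.exp (-(c * Real.log t)) * t ^ (-(σ₁ + 1)))
        = (Real.log t ^ k * Real.exp (-(c * Real.log t))) * (|g t| * t ^ (-(σ₁ + 1))) := by ring
      _ ≤ (Real.log y ^ k * Real.exp (-(c * Real.log y))) * (|g t| * t ^ (-(σ₁ + 1))) :=
          mul_le_mul_of_nonneg_right hw hg0
  have hnonneg : 0 ≤ᵐ[volume.restrict (Ioi y)]
      fun t : ℝ => |g t| * Real.log t ^ k * t ^ (-(lam + 1)) := by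
    rw [Filter.EventuallyLE, ae_restrict_iff' measurableSet_Ioi]
    refine Filter.Eventually.of_forall fun t (ht : y < t) => ?_
    have ht0 : 0 < t := hy0.trans ht
    exact mul_nonneg (mul_nonneg (abs_nonneg _)
      (pow_nonneg (Real.log_nonneg (hy.trans ht.le)) k)) (Real.rpow_nonneg ht0.le _)
  calc ∫ t in Ioi y, |g t| * Real.log t ^ k * t ^ (-(lam + 1))
      ≤ ∫ t in Ioi y, Real.log y ^ k * y ^ (-c) * (|g t| * t ^ (-(σ₁ + 1))) := by
        refine integral_mono_of_nonneg hnonneg (habs_y.const_mul _) ?_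
        rw [Filter.EventuallyLE, ae_restrict_iff' measurableSet_Ioi]
        exact Filter.Eventually.of_forall hpt
    _ = Real.log y ^ k * y ^ (-c) * ∫ t in Ioi y, |g t| * t ^ (-(σ₁ + 1)) :=
        integral_const_mul _ _
    _ ≤ Real.log y ^ k * y ^ (-c) * ∫ t in Ioi 1, |g t| * t ^ (-(σ₁ + 1)) := by
        have h0 : 0 ≤ Real.log y ^ k * y ^ (-c) :=
          mul_nonneg (pow_nonneg (Real.log_nonneg hy) k) (Real.rpow_nonneg hy0.le _)
        refine mul_le_mul_of_nonneg_left ?_ h0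
        refine setIntegral_mono_set habs ?_ (Ioi_subset_Ioi hy).eventuallyLE
        · rw [Filter.EventuallyLE, ae_restrict_iff' measurableSet_Ioi]
          refine Filter.Eventually.of_forall fun t (ht : 1 < t) => ?_
          exact mul_nonneg (abs_nonneg _) (Real.rpow_nonneg (zero_le_one.trans ht.le) _)

/-! ### Moments are Taylor coefficients (no measurability hypothesis on `g`) -/

/-- A measurable modification of `g` on `(1,∞)` exists as soon as `g t^{-(σ₁+1)}` is integrable
there. [folklore] -/
private theorem exists_measurable_ae_eq {g : ℝ → ℝ} {σ₁ : ℝ}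
    (hint : IntegrableOn (fun t : ℝ => g t * t ^ (-(σ₁ + 1))) (Ioi 1)) :
    ∃ g' : ℝ → ℝ, Measurable g' ∧ g =ᵐ[volume.restrict (Ioi 1)] g' := by
  have h1 : AEMeasurable (fun t : ℝ => g t * t ^ (-(σ₁ + 1))) (volume.restrict (Ioi 1)) :=
    hint.aestronglyMeasurable.aemeasurable
  have h2 : AEMeasurable (fun t : ℝ => (g t * t ^ (-(σ₁ + 1))) * t ^ (σ₁ + 1))
      (volume.restrict (Ioi 1)) :=
    h1.mul (measurable_id.pow_const _).aemeasurable
  have h3 : AEMeasurable g (volume.restrict (Ioi 1)) := by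
    refine h2.congr ?_
    rw [Filter.EventuallyEq, ae_restrict_iff' measurableSet_Ioi]
    refine Filter.Eventually.of_forall fun t (ht : 1 < t) => ?_
    have ht0 : 0 < t := one_pos.trans ht
    rw [mul_assoc, ← Real.rpow_add ht0, neg_add_cancel, Real.rpow_zero, mul_one]
  exact ⟨h3.mk g, h3.measurable_mk, h3.ae_eq_mk⟩

/-- **The moments are the Taylor data.**  If `g t^{-(σ₁+1)}` is integrable on `(1,∞)`, `σ₁ < λ`,
and `Ψ = mellinIoi g` on a disc about the real point `λ`, then
`Re Ψ^{(k)}(λ) = (-1)^k ∫_{(1,∞)} g (log t)^k t^{-(λ+1)} dt`, and the latter integrand is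
integrable (differentiation under the integral sign, `Landau.iteratedDeriv_mellinIoi`, applied
to a measurable modification of `g`). [cite: Grosswald1967, §4 Thm B (moment method: moments = derivatives of the Mellin transform)] -/
theorem re_iteratedDeriv_eq_moment {g : ℝ → ℝ} {σ₁ lam r : ℝ} {Ψ : ℂ → ℂ}
    (hint : IntegrableOn (fun t : ℝ => g t * t ^ (-(σ₁ + 1))) (Ioi 1)) (hσ : σ₁ < lam)
    (hr : 0 < r) (hΨ : EqOn Ψ (Landau.mellinIoi g) (ball (lam : ℂ) r)) (k : ℕ) :
    (iteratedDeriv k Ψ (lam : ℂ)).re =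
        (-1) ^ k * ∫ t in Ioi (1 : ℝ), g t * Real.log t ^ k * t ^ (-(lam + 1)) ∧
      Integrable (fun t : ℝ => g t * Real.log t ^ k * t ^ (-(lam + 1)))
        (volume.restrict (Ioi 1)) := by
  obtain ⟨g', hg'm, hgg'⟩ := exists_measurable_ae_eq hint
  have hint' : IntegrableOn (fun t : ℝ => g' t * t ^ (-(σ₁ + 1))) (Ioi 1) :=
    hint.congr (hgg'.mono fun t ht => by simp only [ht])
  have hmell : Landau.mellinIoi g = Landau.mellinIoi g' := by
    funext s
    unfold Landau.mellinIoi
    exact integral_congr_ae (hgg'.mono fun t ht => by simp only [ht])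
  have hs : σ₁ < ((lam : ℂ)).re := by simpa using hσ
  have h1 : iteratedDeriv k Ψ (lam : ℂ) = iteratedDeriv k (Landau.mellinIoi g') (lam : ℂ) := by
    apply Filter.EventuallyEq.iteratedDeriv_eq
    rw [← hmell]
    exact hΨ.eventuallyEq_of_mem (ball_mem_nhds _ hr)
  have hI : ∫ t in Ioi (1 : ℝ), g' t * Real.log t ^ k * t ^ (-(lam + 1)) =
      ∫ t in Ioi (1 : ℝ), g t * Real.log t ^ k * t ^ (-(lam + 1)) :=
    integral_congr_ae (hgg'.mono fun t ht => by simp only [ht])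
  refine ⟨?_, ?_⟩
  · rw [h1, Landau.iteratedDeriv_mellinIoi hg'm hint' k hs, Landau.mellinIoiLog_ofReal,
      Complex.ofReal_re, hI]
  · exact (Landau.integrable_logpow_rpow hg'm hint' k hσ).congr
      (hgg'.mono fun t ht => by simp only [ht])

/-- `g t^{-(λ+1)}` is integrable on `(1, y]` when `g t^{-(σ₁+1)}` is integrable on `(1,∞)` and
`σ₁ ≤ λ` (bounded factor `t^{-(λ−σ₁)} ≤ 1`). [cite: Grosswald1967, §4 Thm B (moment method, truncation)] -/
theorem integrableOn_Ioc_rpow {g : ℝ → ℝ} {σ₁ lam : ℝ}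
    (hint : IntegrableOn (fun t : ℝ => g t * t ^ (-(σ₁ + 1))) (Ioi 1)) (hσ : σ₁ ≤ lam) (y : ℝ) :
    IntegrableOn (fun t : ℝ => g t * t ^ (-(lam + 1))) (Ioc 1 y) := by
  have h1 : IntegrableOn (fun t : ℝ => g t * t ^ (-(σ₁ + 1))) (Ioc 1 y) :=
    hint.mono_set Ioc_subset_Ioi_self
  have h2 : Integrable (fun t : ℝ => t ^ (-(lam - σ₁)) * (g t * t ^ (-(σ₁ + 1))))
      (volume.restrict (Ioc 1 y)) := by
    refine h1.bdd_mul (c := 1) (measurable_id.pow_const _).aestronglyMeasurable ?_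
    rw [ae_restrict_iff' measurableSet_Ioc]
    refine Filter.Eventually.of_forall fun t ht => ?_
    rw [Real.norm_eq_abs, abs_of_pos (Real.rpow_pos_of_pos (one_pos.trans ht.1) _)]
    exact Real.rpow_le_one_of_one_le_of_nonpos ht.1.le (by linarith)
  refine h2.congr ?_
  rw [Filter.EventuallyEq, ae_restrict_iff' measurableSet_Ioc]
  refine Filter.Eventually.of_forall fun t ht => ?_
  have ht0 : 0 < t := one_pos.trans ht.1
  rw [mul_comm, mul_assoc, ← Real.rpow_add ht0]
  congr 2; ring

/-! ### Signs of the full and of the truncated moments -/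

/-- **`stub_polePair_taylor`** (skeleton signature).  Under admissible pole-pair data the sign
of `(-1)^k Re Ψ^{(k)}(λ)` eventually equals the sign of `cos((m+k)φ + α)`,
`φ = arctan(γ/(λ−β))`, on the good indices `|cos((m+k)φ + α)| ≥ 1/2`.
[cite: Grosswald1967, §4 Thm B (moment method: pole-pair asymptotics)] -/
theorem stub_polePair_taylor (g : ℝ → ℝ) (σ₁ lam x R' : ℝ) (ρ : ℂ) (Ψ : ℂ → ℂ)
    (h : AdmissiblePolePair g σ₁ lam x R' ρ Ψ) :
    ∃ (m : ℕ) (α : ℝ) (k₀ : ℕ), 1 ≤ m ∧ ∀ k : ℕ, k₀ ≤ k →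
      1 / 2 ≤ |Real.cos ((m + k : ℝ) * Real.arctan (ρ.im / (lam - ρ.re)) + α)| →
      0 < Real.cos ((m + k : ℝ) * Real.arctan (ρ.im / (lam - ρ.re)) + α) *
        ((-1 : ℝ) ^ k * (iteratedDeriv k Ψ (lam : ℂ)).re) := by
  obtain ⟨-, -, -, him, hre, hR', -, -, -, hdiff, hsymm, -, ⟨m, hm, A, hA, hpole⟩⟩ := h
  obtain ⟨α, c₀, N, ε, hc₀, hε, hNlow, hid⟩ :=
    polePair_asymptotics him hre hR' hdiff hsymm hm hA hpole
  obtain ⟨K₁, hK₁⟩ := Metric.tendsto_atTop.1 hε (1 / 4) (by norm_num)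
  have hR0 : 0 < ‖(lam : ℂ) - ρ‖⁻¹ := by
    refine inv_pos.2 (norm_pos_iff.2 fun h0 => ?_)
    have := congrArg Complex.im h0; simp at this; linarith
  refine ⟨m, α, K₁, hm, fun k hk hcos => ?_⟩
  set ψ := Real.cos ((m + k : ℝ) * Real.arctan (ρ.im / (lam - ρ.re)) + α)
  have hεk : |ε k| < 1 / 4 := by simpa [Real.dist_eq] using hK₁ k hk
  have hNk : 0 < N k := lt_of_lt_of_le (by positivity) (hNlow k)
  have hk0 : (0 : ℝ) < k.factorial := by positivity
  have e1 : (-1 : ℝ) ^ k * (iteratedDeriv k Ψ (lam : ℂ)).re = k.factorial * (N k * (ψ + ε k)) := by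
    rw [← hid k]; field_simp
  rw [e1]
  have hmain : 0 < ψ * (ψ + ε k) := by
    have h1 : |ψ| * (|ψ| - |ε k|) ≤ ψ * (ψ + ε k) := by
      have : ψ * ψ = |ψ| * |ψ| := (abs_mul_abs_self ψ).symm
      nlinarith [abs_mul ψ (ε k), neg_abs_le (ψ * ε k), abs_nonneg ψ]
    nlinarith
  have : ψ * (k.factorial * (N k * (ψ + ε k))) = k.factorial * N k * (ψ * (ψ + ε k)) := by ring
  rw [this]
  positivity

/-- **`stub_truncation`** (skeleton signature with the extra binder `1 ≤ y`).  Under admissible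
pole-pair data the TRUNCATED moments `∫_{(1,y]} g (log t)^k t^{-(λ+1)} dt` with `log y ≥ xk/λ`
have, for `k ≥ k₀` and on the good indices `|cos((m+k)φ+α)| ≥ 1/2`, the sign of
`cos((m+k)φ + α)`: the tail beyond `y` is at most `M k! b^k R^{-k}` with
`b = x e^{1−x(λ−σ₁)/λ} R/λ < 1`, while the full moment is at least `k! c₀ R^{-k}/8` in the good
direction. [cite: Grosswald1967, §4 Thm B (moment method: truncation step)] -/
theorem stub_truncation (g : ℝ → ℝ) (σ₁ lam x R' : ℝ) (ρ : ℂ) (Ψ : ℂ → ℂ)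
    (h : AdmissiblePolePair g σ₁ lam x R' ρ Ψ) :
    ∃ (m : ℕ) (α : ℝ) (k₀ : ℕ), 1 ≤ m ∧ ∀ (k : ℕ) (y : ℝ), k₀ ≤ k → 1 ≤ y →
      x * k / lam ≤ Real.log y →
      1 / 2 ≤ |Real.cos ((m + k : ℝ) * Real.arctan (ρ.im / (lam - ρ.re)) + α)| →
      0 < Real.cos ((m + k : ℝ) * Real.arctan (ρ.im / (lam - ρ.re)) + α) *
        ∫ t in Ioc 1 y, g t * Real.log t ^ k * t ^ (-(lam + 1)) := by
  obtain ⟨hint, hσ, hlam, him, hre, hR', hx, hxσ, htail, hdiff, hsymm, ⟨r, hr, hΨF⟩,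
    ⟨m, hm, A, hA, hpole⟩⟩ := h
  obtain ⟨α, c₀, N, ε, hc₀, hε, hNlow, hid⟩ :=
    polePair_asymptotics him hre hR' hdiff hsymm hm hA hpole
  set R : ℝ := ‖(lam : ℂ) - ρ‖ with hR_def
  have hR0 : 0 < R := by
    refine norm_pos_iff.2 fun h0 => ?_
    have := congrArg Complex.im h0; simp at this; linarith
  set c : ℝ := lam - σ₁ with hc_def
  have hc : 0 < c := sub_pos.2 hσ
  set M : ℝ := ∫ t in Ioi (1 : ℝ), |g t| * t ^ (-(σ₁ + 1)) with hM_def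
  have hM0 : 0 ≤ M := by
    refine setIntegral_nonneg measurableSet_Ioi fun t ht => ?_
    exact mul_nonneg (abs_nonneg _) (Real.rpow_nonneg (zero_le_one.trans (le_of_lt ht)) _)
  -- the tail ratio `b < 1`
  set b : ℝ := x * Real.exp (1 - x * c / lam) * R / lam with hb_def
  have hb0 : 0 ≤ b := by positivity
  have hb1 : b < 1 := by
    rw [hb_def, div_lt_one hlam]; exact htail
  -- good indices: `|ε k| < 1/4` and `M b^k < c₀/8`
  obtain ⟨K₁, hK₁⟩ := Metric.tendsto_atTop.1 hε (1 / 4) (by norm_num)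
  have hMb : Tendsto (fun k : ℕ => M * b ^ k) atTop (𝓝 0) := by
    simpa using (tendsto_pow_atTop_nhds_zero_of_lt_one hb0 hb1).const_mul M
  obtain ⟨K₂, hK₂⟩ := eventually_atTop.1 (hMb.eventually (gt_mem_nhds (by positivity : (0 : ℝ) < c₀ / 8)))
  refine ⟨m, α, max K₁ K₂, hm, fun k y hk hy hky hcos => ?_⟩
  have hk1 : K₁ ≤ k := le_trans (le_max_left _ _) hk
  have hk2 : K₂ ≤ k := le_trans (le_max_right _ _) hk
  set ψ := Real.cos ((m + k : ℝ) * Real.arctan (ρ.im / (lam - ρ.re)) + α) with hψ_def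
  have hψ1 : |ψ| ≤ 1 := Real.abs_cos_le_one _
  have hεk : |ε k| < 1 / 4 := by simpa [Real.dist_eq] using hK₁ k hk1
  have hMbk : M * b ^ k < c₀ / 8 := hK₂ k hk2
  have hk0 : (0 : ℝ) < k.factorial := by positivity
  have hy0 : 0 < y := one_pos.trans_le hy
  -- the full moment, the tail, the truncated moment
  obtain ⟨hmom, hintk⟩ := re_iteratedDeriv_eq_moment hint hσ hr hΨF k
  set mk : ℝ := ∫ t in Ioi (1 : ℝ), g t * Real.log t ^ k * t ^ (-(lam + 1)) with hmk_def
  set tl : ℝ := ∫ t in Ioi y, g t * Real.log t ^ k * t ^ (-(lam + 1)) with htl_def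
  have hsplit : ∫ t in Ioc 1 y, g t * Real.log t ^ k * t ^ (-(lam + 1)) = mk - tl := by
    have hu : Ioc 1 y ∪ Ioi y = Ioi 1 := Ioc_union_Ioi_eq_Ioi hy
    have hintk' : IntegrableOn (fun t : ℝ => g t * Real.log t ^ k * t ^ (-(lam + 1))) (Ioi 1) :=
      hintk
    have := setIntegral_union (Ioc_disjoint_Ioi le_rfl) measurableSet_Ioi
      (hintk'.mono_set Ioc_subset_Ioi_self) (hintk'.mono_set (Ioi_subset_Ioi hy))
    rw [hu] at this
    rw [hmk_def, htl_def, this]; ring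
  -- (i) the main term in the good direction
  have hNk : 0 < N k := lt_of_lt_of_le (by positivity) (hNlow k)
  have hmain : k.factorial * (c₀ * R⁻¹ ^ k) / 8 ≤ ψ * mk := by
    have e1 : mk = k.factorial * (N k * (ψ + ε k)) := by
      have : mk = (-1 : ℝ) ^ k * (iteratedDeriv k Ψ (lam : ℂ)).re := by
        rw [hmom, ← mul_assoc, ← pow_add, ← two_mul, pow_mul, neg_one_sq, one_pow, one_mul]
      rw [this, ← hid k]; field_simp
    have h1 : 1 / 8 ≤ ψ * (ψ + ε k) := by
      have : ψ * ψ = |ψ| * |ψ| := (abs_mul_abs_self ψ).symm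
      nlinarith [abs_mul ψ (ε k), neg_abs_le (ψ * ε k), abs_nonneg ψ, abs_nonneg (ε k)]
    rw [e1]
    have h2 : k.factorial * (c₀ * R⁻¹ ^ k) / 8 ≤ k.factorial * N k * (1 / 8) := by
      have := hNlow k
      have : k.factorial * (c₀ * R⁻¹ ^ k) ≤ k.factorial * N k :=
        mul_le_mul_of_nonneg_left this hk0.le
      linarith
    calc (k.factorial : ℝ) * (c₀ * R⁻¹ ^ k) / 8 ≤ k.factorial * N k * (1 / 8) := h2
      _ ≤ k.factorial * N k * (ψ * (ψ + ε k)) :=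
          mul_le_mul_of_nonneg_left h1 (by positivity)
      _ = ψ * (k.factorial * (N k * (ψ + ε k))) := by ring
  -- (ii) the tail
  have htl : |tl| < k.factorial * (c₀ * R⁻¹ ^ k) / 8 := by
    have hxk : (k : ℝ) / c ≤ x * k / lam := by
      rw [div_le_div_iff₀ hc hlam]
      have := mul_le_mul_of_nonneg_left hxσ (Nat.cast_nonneg k)
      nlinarith
    have hk' : (k : ℝ) / c ≤ Real.log y := hxk.trans hky
    have h1 : |tl| ≤ ∫ t in Ioi y, |g t| * Real.log t ^ k * t ^ (-(lam + 1)) := by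
      rw [htl_def]
      refine (abs_integral_le_integral_abs).trans (le_of_eq ?_)
      refine setIntegral_congr_fun measurableSet_Ioi fun t ht => ?_
      have ht0 : 0 < t := hy0.trans ht
      rw [abs_mul, abs_mul, abs_of_nonneg (pow_nonneg (Real.log_nonneg (hy.trans ht.le)) k),
        abs_of_pos (Real.rpow_pos_of_pos ht0 _)]
    have h2 := stub_tail g σ₁ lam y k hσ hy hk' hint
    have h3 : Real.log y ^ k * y ^ (-(lam - σ₁)) ≤
        (x * k / lam) ^ k * Real.exp (-(c * (x * k / lam))) := by
      have := pow_mul_exp_neg_le hc hxk hky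
      rwa [Real.rpow_def_of_pos hy0, show Real.log y * (-(lam - σ₁)) = -(c * Real.log y) by
        rw [hc_def]; ring]
    -- `(xk/λ)^k e^{-cxk/λ} ≤ k! (b/R)^k`
    have h4 : (x * k / lam) ^ k * Real.exp (-(c * (x * k / lam))) ≤
        k.factorial * (b / R) ^ k := by
      have hkk : (k : ℝ) ^ k ≤ Real.exp k * k.factorial := by
        have := Real.pow_div_factorial_le_exp (k : ℝ) (Nat.cast_nonneg k) k
        rwa [div_le_iff₀ hk0] at this
      have hbR : b / R = x / lam * Real.exp (1 - x * c / lam) := by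
        rw [hb_def]; field_simp
      have e2 : (x * k / lam) ^ k * Real.exp (-(c * (x * k / lam))) =
          (k : ℝ) ^ k * ((x / lam) ^ k * Real.exp (-(c * (x * k / lam)))) := by ring
      have e3 : (k.factorial : ℝ) * (b / R) ^ k =
          (Real.exp k * k.factorial) * ((x / lam) ^ k * Real.exp (-(c * (x * k / lam)))) := by
        rw [hbR, mul_pow, ← Real.exp_nat_mul, show (k : ℝ) * (1 - x * c / lam) =
          k + -(c * (x * k / lam)) by field_simp; ring, Real.exp_add]
        ring
      rw [e2, e3]
      exact mul_le_mul_of_nonneg_right hkk (by positivity)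
    calc |tl| ≤ ∫ t in Ioi y, |g t| * Real.log t ^ k * t ^ (-(lam + 1)) := h1
      _ ≤ Real.log y ^ k * y ^ (-(lam - σ₁)) * M := h2
      _ ≤ (x * k / lam) ^ k * Real.exp (-(c * (x * k / lam))) * M :=
          mul_le_mul_of_nonneg_right h3 hM0
      _ ≤ k.factorial * (b / R) ^ k * M := mul_le_mul_of_nonneg_right h4 hM0
      _ = k.factorial * R⁻¹ ^ k * (M * b ^ k) := by rw [div_pow, div_eq_mul_inv, ← inv_pow]; ring
      _ < k.factorial * R⁻¹ ^ k * (c₀ / 8) := by gcongr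
      _ = k.factorial * (c₀ * R⁻¹ ^ k) / 8 := by ring
  -- (iii) combine
  rw [hsplit, mul_sub]
  have : ψ * tl ≤ |tl| := by
    calc ψ * tl ≤ |ψ * tl| := le_abs_self _
      _ = |ψ| * |tl| := abs_mul _ _
      _ ≤ 1 * |tl| := mul_le_mul_of_nonneg_right hψ1 (abs_nonneg _)
      _ = |tl| := one_mul _
  linarith

end PolyaSignChanges

end Literature.NumberTheory.LFunctions

end
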